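import Literature.NumberTheory.Sieve.MontgomeryVaughan1975DensityProofs
import HarnessLib

/-!
# Hoheisel's theorem: primes in all short intervals `(x − x^θ, x]`, `θ < 1`

Topic `Literature/NumberTheory/Sieve`. THEOREMS only (no definition, no named fact, no `sorry`).
Reproduction of published work: G. Hoheisel, *Primzahlprobleme in der Analysis*, S.-B. Preuss. Akad.
Wiss. (1930) 580–588 — **there is `θ < 1` such that every interval `(x − x^θ, x]`, `x ≥ x₀`, contains
a prime; indeed `∑_{x−h<p≤x} log p ≍ h` for `x^{1−δ} ≤ h ≤ x`.**  (Later exponents: Ingham `5/8 + ε`,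
Huxley `7/12 + ε`, Baker–Harman–Pintz `0.525`, Guth–Maynard `17/30 + ε` — not reproduced here.)

The tree holds Gallagher's prime number theorem in Montgomery–Vaughan's short-interval form
(`MontgomeryVaughan1975.lemma43_gallagher`, Gallagher, Invent. Math. 11 (1970), Theorem 7, with the
`max_{x ≤ N} max_{h ≤ N}` built in; DISCHARGED as `MontgomeryVaughan1975.lemma43_gallagher_holds`).  Its
term `q = 1` reads `|∑_{x−h<p≤x} log p − h| ≤ (h + N/P) · C e^{−c₃ log N/log P}` (in the presence of
the exceptional zero the right-hand side carries the extra factor `(1 − β̃) log P ≤ c₁`, and the term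
`q = 1` is never the corrected one since `r̃ ≥ 2`).  With `P = N^δ`, `δ` small, this is
`≤ (h + N^{1−δ})/8`, whence the theorem.

Main results:
* `Hoheisel.theta_shortInterval_bounds` — `∃ δ > 0, N₀: ∀ N ≥ N₀, ∀ x ≤ N, ∀ h ≤ x` with
  `N^{1−δ} ≤ h`: `3h/4 ≤ ∑_{x−h<p≤x} log p ≤ 5h/4`;
* `Hoheisel.exists_prime_mem_Ioc` — `∃ δ > 0, N₀: ∀ N ≥ N₀, ∀ h`, `N^{1−δ} ≤ h ≤ N`, a prime in
  `(N − h, N]`;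
* `Literature.NumberTheory.Sieve.hoheisel_primes_short_intervals` — **Hoheisel's theorem**:
  `∃ θ < 1, ∃ x₀, ∀ x ≥ x₀, ∃ p prime, x − x^θ < p ≤ x`.

## References

* [Hoheisel1930] G. Hoheisel, *Primzahlprobleme in der Analysis*, Sitzungsber. Preuss. Akad. Wiss.
  33 (1930) 580–588.
* [Gallagher1970Density] P. X. Gallagher, Invent. Math. 11 (1970) 329–339, Theorem 7.
* [MontgomeryVaughanActa1975] H. L. Montgomery, R. C. Vaughan, Acta Arith. 27 (1975), §4 Lemma 4.3.
-/

noncomputable section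

open Finset Real

namespace Literature.NumberTheory.Sieve

namespace Hoheisel

open MontgomeryVaughan1975 Literature.NumberTheory.LFunctions

/-- The prime sum of the trivial character mod `1` is `θ(x) − θ(x − h)`:
`charPrimeSum 1 x h = ∑_{x−h<p≤x} log p`. [folklore] -/
theorem charPrimeSum_one (x h : ℕ) :
    charPrimeSum (1 : DirichletCharacter ℂ 1) x h =
      ((∑ p ∈ (Ioc (x - h) x).filter Nat.Prime, Real.log p : ℝ) : ℂ) := by
  rw [charPrimeSum]
  push_cast
  refine Finset.sum_congr rfl fun p _ => ?_
  rw [MulChar.one_apply (isUnit_of_subsingleton _), one_mul]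

/-- The `q = 1` term of Lemma 4.3: `gallagherTerm 1 x h = (∑_{x−h<p≤x} log p) − h` for `h ≤ x`.
[folklore] -/
theorem gallagherTerm_one (x h : ℕ) (hhx : h ≤ x) :
    gallagherTerm (1 : DirichletCharacter ℂ 1) x h =
      ((∑ p ∈ (Ioc (x - h) x).filter Nat.Prime, Real.log p : ℝ) : ℂ) - (h : ℂ) := by
  rw [gallagherTerm, charPrimeSum_one, if_pos rfl, Nat.card_Ioc]
  congr 2
  omega

open scoped Classical in
/-- The exceptional correction never touches the term `q = 1` (the exceptional modulus is `≥ 2`).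
[folklore] -/
theorem gallagherTermExc_one {c₁ P : ℝ} {r : ℕ} [NeZero r] {χe : DirichletCharacter ℂ r} {β : ℝ}
    (hexc : IsExceptionalZero c₁ P r χe β) (x h : ℕ) :
    gallagherTermExc χe β (1 : DirichletCharacter ℂ 1) x h = gallagherTerm (1 : DirichletCharacter ℂ 1) x h := by
  rw [gallagherTermExc, if_neg, add_zero]
  rintro ⟨hr, -⟩
  obtain ⟨-, hne, -⟩ := hexc
  subst hr
  exact hne (DirichletCharacter.level_one χe)

open scoped Classical in
/-- A single non-negative term of the double sum of Lemma 4.3 is bounded by the whole sum: the term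
`q = 1`, `χ = 1`. [folklore] -/
theorem term_one_le_sum {P : ℝ} (hP : 1 ≤ P) (G : (q : ℕ) → DirichletCharacter ℂ q → ℝ)
    (hG : ∀ q ψ, 0 ≤ G q ψ) :
    G 1 1 ≤ ∑ q ∈ Icc 1 ⌊P⌋₊, ∑ χ : DirichletCharacter ℂ q with χ.IsPrimitive, G q χ := by
  have h1 : 1 ∈ Icc 1 ⌊P⌋₊ := by
    rw [Finset.mem_Icc]
    refine ⟨le_rfl, Nat.le_floor ?_⟩
    rw [Nat.cast_one]; exact hP
  have hinner : G 1 1 ≤ ∑ χ : DirichletCharacter ℂ 1 with χ.IsPrimitive, G 1 χ := by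
    have hmem : (1 : DirichletCharacter ℂ 1) ∈
        (Finset.univ : Finset (DirichletCharacter ℂ 1)).filter (fun χ => χ.IsPrimitive) := by
      rw [Finset.mem_filter]
      exact ⟨Finset.mem_univ _, DirichletCharacter.isPrimitive_one_level_one⟩
    exact Finset.single_le_sum (f := G 1) (fun χ _ => hG 1 χ) hmem
  have houter : ∑ χ : DirichletCharacter ℂ 1 with χ.IsPrimitive, G 1 χ ≤
      ∑ q ∈ Icc 1 ⌊P⌋₊, ∑ χ : DirichletCharacter ℂ q with χ.IsPrimitive, G q χ :=
    Finset.single_le_sum (s := Icc 1 ⌊P⌋₊)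
      (f := fun q => ∑ χ : DirichletCharacter ℂ q with χ.IsPrimitive, G q χ)
      (fun q _ => Finset.sum_nonneg fun χ _ => hG q χ) h1
  exact hinner.trans houter

open scoped Classical in
/-- **`θ(x) − θ(x − h) ≍ h` in all short intervals `N^{1−δ} ≤ h ≤ x ≤ N`** (Hoheisel; here from
Gallagher's Theorem 7): there are `δ > 0` and `N₀` such that for `N ≥ N₀`, `x ≤ N`, `h ≤ x`,
`N^{1−δ} ≤ h`: `3h/4 ≤ ∑_{x−h<p≤x} log p ≤ 5h/4`. [cite: Hoheisel1930]
[cite: Gallagher1970Density, Theorem 7] [cite: MontgomeryVaughanActa1975, §4 Lemma 4.3] -/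
theorem theta_shortInterval_bounds :
    ∃ δ : ℝ, 0 < δ ∧ δ < 1 ∧ ∃ N₀ : ℕ, ∀ N : ℕ, N₀ ≤ N → ∀ x h : ℕ, x ≤ N → h ≤ x →
      (N : ℝ) ^ (1 - δ) ≤ h →
        3 / 4 * (h : ℝ) ≤ ∑ p ∈ (Ioc (x - h) x).filter Nat.Prime, Real.log p ∧
          ∑ p ∈ (Ioc (x - h) x).filter Nat.Prime, Real.log p ≤ 5 / 4 * (h : ℝ) := by
  obtain ⟨c₁, hc₁, c₃, hc₃, c₄, hc₄, C, h43⟩ := lemma43_gallagher_holds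
  set K : ℝ := max C 1 with hK
  set c₁' : ℝ := max c₁ 1 with hc₁'
  have hK1 : 1 ≤ K := le_max_right _ _
  have hc₁'1 : 1 ≤ c₁' := le_max_right _ _
  have hCK : C ≤ K := le_max_left _ _
  have hL0 : 0 < Real.log (8 * K * c₁') + 1 := by
    have : 0 ≤ Real.log (8 * K * c₁') := Real.log_nonneg (by nlinarith)
    linarith
  set δ : ℝ := min (min c₄ (1 / 2)) (c₃ / (Real.log (8 * K * c₁') + 1)) with hδ
  have hδ0 : 0 < δ := by positivity
  have hδc₄ : δ ≤ c₄ := (min_le_left _ _).trans (min_le_left _ _)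
  have hδ2 : δ ≤ 1 / 2 := (min_le_left _ _).trans (min_le_right _ _)
  have hδc₃ : δ ≤ c₃ / (Real.log (8 * K * c₁') + 1) := min_le_right _ _
  -- `e^{−c₃/δ} · 8 K c₁' ≤ 1`
  have hE : Real.exp (-(c₃ / δ)) * (8 * K * c₁') ≤ 1 := by
    have h1 : Real.log (8 * K * c₁') + 1 ≤ c₃ / δ := by
      rw [le_div_iff₀ hδ0]
      have := (le_div_iff₀ hL0).mp hδc₃
      linarith
    have h2 : 8 * K * c₁' ≤ Real.exp (c₃ / δ) := by
      calc 8 * K * c₁' = Real.exp (Real.log (8 * K * c₁')) := (Real.exp_log (by positivity)).symm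
        _ ≤ Real.exp (c₃ / δ) := Real.exp_le_exp.mpr (by linarith)
    have h3 : Real.exp (-(c₃ / δ)) * Real.exp (c₃ / δ) = 1 := by rw [← Real.exp_add]; simp
    calc Real.exp (-(c₃ / δ)) * (8 * K * c₁') ≤ Real.exp (-(c₃ / δ)) * Real.exp (c₃ / δ) :=
          mul_le_mul_of_nonneg_left h2 (Real.exp_pos _).le
      _ = 1 := h3
  -- `N₀`: `log N ≥ 1/δ²` and `N ≥ 2`
  obtain ⟨N₀, hN₀⟩ : ∃ N₀ : ℕ, ∀ N : ℕ, N₀ ≤ N → 1 / δ ^ 2 ≤ Real.log N ∧ 2 ≤ N := by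
    obtain ⟨M, hM⟩ := (Filter.tendsto_atTop.mp (Real.tendsto_log_atTop.comp
      tendsto_natCast_atTop_atTop) (1 / δ ^ 2)).exists_forall_of_atTop.imp fun M h => h
    refine ⟨max M 2, fun N hN => ⟨hM N ((le_max_left _ _).trans hN), (le_max_right _ _).trans hN⟩⟩
  refine ⟨δ, hδ0, by linarith, N₀, fun N hN x h hxN hhx hNh => ?_⟩
  obtain ⟨hlogN, hN2⟩ := hN₀ N hN
  have hN1 : (1 : ℝ) < N := by exact_mod_cast hN2
  have hN0 : (0 : ℝ) < N := by linarith
  have hlogN0 : 0 < Real.log N := Real.log_pos hN1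
  set P : ℝ := (N : ℝ) ^ δ with hP
  have hP1 : 1 ≤ P := Real.one_le_rpow hN1.le hδ0.le
  have hP0 : 0 < P := by linarith
  have hlogP : Real.log P = δ * Real.log N := by rw [hP, Real.log_rpow hN0]
  -- the range of Lemma 4.3
  have hrange1 : Real.exp (Real.sqrt (Real.log N)) ≤ P := by
    rw [hP, Real.rpow_def_of_pos hN0, Real.exp_le_exp]
    refine Real.sqrt_le_iff.mpr ⟨by positivity, ?_⟩
    -- `log N ≤ (δ log N)²` iff `1 ≤ δ² log N`
    have h1 : 1 ≤ δ ^ 2 * Real.log N := by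
      rw [div_le_iff₀ (by positivity)] at hlogN; linarith
    nlinarith
  have hrange2 : P ≤ (N : ℝ) ^ c₄ := Real.rpow_le_rpow_of_exponent_le hN1.le hδc₄
  -- Lemma 4.3 with the constant choice functions `x`, `h`
  obtain ⟨hA, hB⟩ := h43 N P hrange1 hrange2 (fun _ _ => x) (fun _ _ => h) (fun _ _ => hxN)
    (fun _ _ => hhx.trans hxN)
  have hEeq : Real.exp (-c₃ * Real.log N / Real.log P) = Real.exp (-(c₃ / δ)) := by
    rw [hlogP]; congr 1; field_simp
  -- the `q = 1` term, in both cases: `‖gallagherTerm 1 x h‖ ≤ (h + N/P) K c₁' e^{−c₃/δ}`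
  have hNP : 0 < (h : ℝ) + N / P := by positivity
  have hterm : ‖gallagherTerm (1 : DirichletCharacter ℂ 1) x h‖ ≤
      ((h : ℝ) + N / P) * (K * c₁' * Real.exp (-(c₃ / δ))) := by
    rw [← inv_mul_le_iff₀ hNP]
    by_cases hex : ∃ (r : ℕ) (_ : NeZero r) (χe : DirichletCharacter ℂ r) (β : ℝ),
        IsExceptionalZero c₁ P r χe β
    · obtain ⟨r, hr, χe, β, hexc⟩ := hex
      have hB' := hB r χe β hexc
      have hle := term_one_le_sum hP1
        (fun q ψ => ((h : ℝ) + N / P)⁻¹ * ‖gallagherTermExc χe β ψ x h‖) (fun q ψ => by positivity)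
      rw [gallagherTermExc_one hexc] at hle
      refine (hle.trans hB').trans ?_
      rw [hEeq]
      obtain ⟨-, -, -, hβ, hβ1, -⟩ := hexc
      have hlogP0 : 0 < Real.log P := by rw [hlogP]; positivity
      have hδlog : (1 - β) * Real.log P ≤ c₁ := by
        have h1 : 1 - β ≤ c₁ / Real.log P := by linarith
        calc (1 - β) * Real.log P ≤ c₁ / Real.log P * Real.log P :=
              mul_le_mul_of_nonneg_right h1 hlogP0.le
          _ = c₁ := div_mul_cancel₀ c₁ hlogP0.ne'
      have hnn : 0 ≤ (1 - β) * Real.log P := mul_nonneg (by linarith) hlogP0.le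
      calc C * ((1 - β) * Real.log P) * Real.exp (-(c₃ / δ))
          ≤ K * ((1 - β) * Real.log P) * Real.exp (-(c₃ / δ)) := by gcongr
        _ ≤ K * c₁' * Real.exp (-(c₃ / δ)) := by
            refine mul_le_mul_of_nonneg_right (mul_le_mul_of_nonneg_left
              (hδlog.trans (le_max_left _ _)) (by linarith)) (Real.exp_pos _).le
    · push Not at hex
      have hA' := hA (fun r _ χ β hx => hex r inferInstance χ β hx)
      have hle := term_one_le_sum hP1
        (fun q ψ => ((h : ℝ) + N / P)⁻¹ * ‖gallagherTerm ψ x h‖) (fun q ψ => by positivity)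
      refine (hle.trans hA').trans ?_
      rw [hEeq]
      calc C * Real.exp (-(c₃ / δ)) ≤ K * Real.exp (-(c₃ / δ)) := by gcongr
        _ = K * 1 * Real.exp (-(c₃ / δ)) := by ring
        _ ≤ K * c₁' * Real.exp (-(c₃ / δ)) := by gcongr
  -- `N/P = N^{1−δ} ≤ h`, so the error is `≤ 2h K c₁' e^{−c₃/δ} ≤ h/4`
  have hNPh : (N : ℝ) / P ≤ h := by
    rw [hP, div_eq_mul_inv, ← Real.rpow_neg hN0.le, ← Real.rpow_one_add' hN0.le (by linarith)]
    rwa [← sub_eq_add_neg]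
  have herr : ‖gallagherTerm (1 : DirichletCharacter ℂ 1) x h‖ ≤ (h : ℝ) / 4 := by
    refine hterm.trans ?_
    have h1 : ((h : ℝ) + N / P) * (K * c₁' * Real.exp (-(c₃ / δ))) ≤
        (2 * h) * (K * c₁' * Real.exp (-(c₃ / δ))) :=
      mul_le_mul_of_nonneg_right (by linarith) (by positivity)
    have h2 : (2 * (h : ℝ)) * (K * c₁' * Real.exp (-(c₃ / δ))) =
        h / 4 * (Real.exp (-(c₃ / δ)) * (8 * K * c₁')) := by ring
    rw [h2] at h1
    exact h1.trans (mul_le_of_le_one_right (by positivity) hE)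
  -- conclude from `gallagherTerm 1 x h = θ-sum − h`
  rw [gallagherTerm_one x h hhx, ← Complex.ofReal_natCast, ← Complex.ofReal_sub, Complex.norm_real,
    Real.norm_eq_abs] at herr
  obtain ⟨h1, h2⟩ := abs_le.mp herr
  constructor <;> linarith

/-- **Primes in all short intervals `(N − h, N]`, `N^{1−δ} ≤ h ≤ N`** (Hoheisel).
[cite: Hoheisel1930] -/
theorem exists_prime_mem_Ioc :
    ∃ δ : ℝ, 0 < δ ∧ δ < 1 ∧ ∃ N₀ : ℕ, ∀ N : ℕ, N₀ ≤ N → ∀ h : ℕ, h ≤ N → (N : ℝ) ^ (1 - δ) ≤ h →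
      ∃ p : ℕ, p.Prime ∧ N - h < p ∧ p ≤ N := by
  obtain ⟨δ, hδ0, hδ1, N₀, hN₀⟩ := theta_shortInterval_bounds
  refine ⟨δ, hδ0, hδ1, max N₀ 1, fun N hN h hhN hNh => ?_⟩
  obtain ⟨hlow, -⟩ := hN₀ N ((le_max_left _ _).trans hN) N h le_rfl hhN hNh
  have hh0 : (0 : ℝ) < h := by
    have hN1 : (1 : ℝ) ≤ N := by exact_mod_cast (le_max_right N₀ 1).trans hN
    exact lt_of_lt_of_le (Real.rpow_pos_of_pos (by linarith) _) hNh
  have hne : ((Ioc (N - h) N).filter Nat.Prime).Nonempty := by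
    by_contra hemp
    rw [Finset.not_nonempty_iff_eq_empty] at hemp
    rw [hemp, Finset.sum_empty] at hlow
    linarith
  obtain ⟨p, hp⟩ := hne
  simp only [Finset.mem_filter, Finset.mem_Ioc] at hp
  exact ⟨p, hp.2, hp.1.1, hp.1.2⟩

end Hoheisel

/-- **HOHEISEL'S THEOREM** (1930), unconditional: there is `θ < 1` such that for all real
`x ≥ x₀` the interval `(x − x^θ, x]` contains a prime.  From Gallagher's prime number theorem in
short intervals (`MontgomeryVaughan1975.lemma43_gallagher_holds`: explicit formulae, Bombieri's
log-free zero-density theorem, the Deuring–Heilbronn phenomenon — all theorems of the tree).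
[cite: Hoheisel1930] [cite: Gallagher1970Density, Theorem 7] -/
theorem hoheisel_primes_short_intervals :
    ∃ θ : ℝ, θ < 1 ∧ ∃ x₀ : ℝ, ∀ x : ℝ, x₀ ≤ x → ∃ p : ℕ, p.Prime ∧ x - x ^ θ < p ∧ (p : ℝ) ≤ x := by
  obtain ⟨δ, hδ0, hδ1, N₀, hN₀⟩ := Hoheisel.exists_prime_mem_Ioc
  -- `θ = 1 − δ/2`; for `x` large, `h = ⌈N^{1−δ}⌉ ≤ N` and `x − x^θ ≤ N − h`
  obtain ⟨M, hM⟩ : ∃ M : ℝ, ∀ x : ℝ, M ≤ x → (4 : ℝ) ≤ x ^ (δ / 2) := by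
    obtain ⟨M, hM⟩ := (Filter.tendsto_atTop.mp (tendsto_rpow_atTop (by positivity : 0 < δ / 2)) 4)
      |>.exists_forall_of_atTop.imp fun M h => h
    exact ⟨M, hM⟩
  refine ⟨1 - δ / 2, by linarith, max (max M 4) (N₀ + 1), fun x hx => ?_⟩
  have hxM : M ≤ x := (le_max_left _ _).trans ((le_max_left _ _).trans hx)
  have hx2 : (4 : ℝ) ≤ x := (le_max_right _ _).trans ((le_max_left _ _).trans hx)
  have hxN₀ : (N₀ : ℝ) + 1 ≤ x := (le_max_right _ _).trans hx
  have hx0 : 0 < x := by linarith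
  set N : ℕ := ⌊x⌋₊ with hN
  have hNx : (N : ℝ) ≤ x := Nat.floor_le hx0.le
  have hxN : x < N + 1 := Nat.lt_floor_add_one x
  have hN₀N : N₀ ≤ N := by
    have : (N₀ : ℝ) < N + 1 := by linarith
    exact_mod_cast Nat.lt_succ_iff.mp (by exact_mod_cast this)
  have hN1 : (1 : ℝ) ≤ N := by
    have : (1 : ℝ) < N + 1 := by linarith
    have h1 : 1 ≤ N := Nat.lt_succ_iff.mp (by exact_mod_cast this)
    exact_mod_cast h1
  have hN0 : (0 : ℝ) < N := by linarith
  set h : ℕ := ⌈(N : ℝ) ^ (1 - δ)⌉₊ with hh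
  have hNh : (N : ℝ) ^ (1 - δ) ≤ h := Nat.le_ceil _
  have hhlt : (h : ℝ) < (N : ℝ) ^ (1 - δ) + 1 := Nat.ceil_lt_add_one (by positivity)
  -- `N^{1−δ} + 1 ≤ x^{1−δ} + 1`, and `x^θ = x^{1−δ/2} ≥ 4 x^{1−δ}`... we need `h ≤ N` and `x − x^θ ≤ N − h`
  have hx1δ : (N : ℝ) ^ (1 - δ) ≤ x ^ (1 - δ) := Real.rpow_le_rpow hN0.le hNx (by linarith)
  have hxθ : 4 * x ^ (1 - δ) ≤ x ^ (1 - δ / 2) := by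
    have e : x ^ (1 - δ / 2) = x ^ (1 - δ) * x ^ (δ / 2) := by
      rw [← Real.rpow_add hx0]; ring_nf
    rw [e]
    have := hM x hxM
    have h0 : 0 ≤ x ^ (1 - δ) := by positivity
    nlinarith
  have hx1δ1 : 1 ≤ x ^ (1 - δ) := Real.one_le_rpow (by linarith) (by linarith)
  have hx1δx : x ^ (1 - δ) ≤ x / 2 := by
    -- `x^{1−δ} · x^{δ} = x` and `x^δ ≥ x^{δ/2} ≥ 4 ≥ 2`
    have e : x = x ^ (1 - δ) * x ^ δ := by
      rw [← Real.rpow_add hx0]; simp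
    have hxδ : (2 : ℝ) ≤ x ^ δ := by
      have h1 : x ^ (δ / 2) ≤ x ^ δ := Real.rpow_le_rpow_of_exponent_le (by linarith) (by linarith)
      linarith [hM x hxM]
    have h0 : 0 ≤ x ^ (1 - δ) := by positivity
    nlinarith
  have hhN : h ≤ N := by
    have : (h : ℝ) ≤ N := by linarith
    exact_mod_cast this
  obtain ⟨p, hp, hpl, hpu⟩ := hN₀ N hN₀N h hhN hNh
  refine ⟨p, hp, ?_, le_trans (by exact_mod_cast hpu) hNx⟩
  have hpl' : (N : ℝ) - h < p := by
    have h1 : ((N - h : ℕ) : ℝ) = (N : ℝ) - h := by push_cast [Nat.cast_sub hhN]; ring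
    have h2 : ((N - h : ℕ) : ℝ) < p := by exact_mod_cast hpl
    linarith
  linarith

/-- **Hoheisel's theorem in the gap form**: there is `θ < 1` with `p_{n+1} − p_n < p_{n+1}^θ` for all
large `n` (`p_n = Nat.nth Nat.Prime n`; apply `hoheisel_primes_short_intervals` at `x = p_{n+1} − 1`:
the prime found is `≤ p_n`). [cite: Hoheisel1930] -/
theorem primeGap_lt_rpow :
    ∃ θ : ℝ, θ < 1 ∧ ∃ n₀ : ℕ, ∀ n : ℕ, n₀ ≤ n →
      (Nat.nth Nat.Prime (n + 1) : ℝ) - (Nat.nth Nat.Prime n : ℝ) < (Nat.nth Nat.Prime (n + 1) : ℝ) ^ θ := by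
  obtain ⟨θ₀, hθ₀, x₀, hx₀⟩ := hoheisel_primes_short_intervals
  have hinf : (setOf Nat.Prime).Infinite := Nat.infinite_setOf_prime
  -- `θ₁ = max θ₀ (1/2) ∈ [1/2, 1)`, `θ = (1 + θ₁)/2`; `n₀` with `p_{n+1} − 1 ≥ x₀`, `p_{n+1}^{θ − θ₁} ≥ 2`
  set θ₁ : ℝ := max θ₀ (1 / 2) with hθ₁
  have hθ₁1 : θ₁ < 1 := max_lt hθ₀ (by norm_num)
  have hθ₁0 : 0 ≤ θ₁ := le_trans (by norm_num) (le_max_right _ _)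
  have hθ₀₁ : θ₀ ≤ θ₁ := le_max_left _ _
  set θ : ℝ := (1 + θ₁) / 2 with hθ
  have hθθ₁ : 0 < θ - θ₁ := by rw [hθ]; linarith
  obtain ⟨M, hM⟩ : ∃ M : ℝ, ∀ y : ℝ, M ≤ y → (2 : ℝ) ≤ y ^ (θ - θ₁) :=
    (Filter.tendsto_atTop.mp (tendsto_rpow_atTop hθθ₁) 2).exists_forall_of_atTop.imp fun M h => h
  refine ⟨θ, by rw [hθ]; linarith, ⌈max (x₀ + 1) (max M 2)⌉₊, fun n hn => ?_⟩
  set q : ℕ := Nat.nth Nat.Prime (n + 1) with hq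
  -- `q ≥ n + 1 ≥ ⌈…⌉`
  have hqn : n + 1 ≤ q := (Nat.nth_strictMono hinf).id_le (n + 1)
  have hqR : max (x₀ + 1) (max M 2) ≤ (q : ℝ) := by
    have h1 : (⌈max (x₀ + 1) (max M 2)⌉₊ : ℝ) ≤ n := by exact_mod_cast hn
    have h2 : (n : ℝ) ≤ q := by exact_mod_cast (Nat.le_succ n).trans hqn
    exact (Nat.le_ceil _).trans (h1.trans h2)
  have hqx₀ : x₀ ≤ (q : ℝ) - 1 := by linarith [le_max_left (x₀ + 1) (max M 2)]
  have hqM : M ≤ (q : ℝ) := (le_max_left _ _).trans ((le_max_right _ _).trans hqR)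
  have hq2 : (2 : ℝ) ≤ q := (le_max_right _ _).trans ((le_max_right _ _).trans hqR)
  obtain ⟨p, hp, hpl, hpu⟩ := hx₀ ((q : ℝ) - 1) hqx₀
  -- `p < q = p_{n+1}`, hence `p ≤ p_n`
  have hpq : p < q := by
    have : (p : ℝ) < q := by linarith
    exact_mod_cast this
  have hple : p ≤ Nat.nth Nat.Prime n := by
    have h1 : Nat.nth Nat.Prime (Nat.count Nat.Prime p) = p := Nat.nth_count hp
    have h2 : Nat.count Nat.Prime p < n + 1 := by
      rw [← Nat.nth_lt_nth hinf, h1]; exact hpq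
    calc p = Nat.nth Nat.Prime (Nat.count Nat.Prime p) := h1.symm
      _ ≤ Nat.nth Nat.Prime n := (Nat.nth_le_nth hinf).mpr (Nat.lt_succ_iff.mp h2)
  have hpleR : (p : ℝ) ≤ Nat.nth Nat.Prime n := by exact_mod_cast hple
  -- `(q − 1)^{θ₀} ≤ (q − 1)^{θ₁} ≤ q^{θ₁}` and `q^{θ₁} + 1 ≤ q^{θ}`
  have hq11 : (1 : ℝ) ≤ (q : ℝ) - 1 := by linarith
  have h0 : ((q : ℝ) - 1) ^ θ₀ ≤ ((q : ℝ) - 1) ^ θ₁ :=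
    Real.rpow_le_rpow_of_exponent_le hq11 hθ₀₁
  have h1 : ((q : ℝ) - 1) ^ θ₁ ≤ (q : ℝ) ^ θ₁ :=
    Real.rpow_le_rpow (by linarith) (by linarith) hθ₁0
  have h2 : (q : ℝ) ^ θ₁ + 1 ≤ (q : ℝ) ^ θ := by
    have e : (q : ℝ) ^ θ = (q : ℝ) ^ θ₁ * (q : ℝ) ^ (θ - θ₁) := by
      rw [← Real.rpow_add (by linarith)]; ring_nf
    rw [e]
    have h3 := hM q hqM
    have h4 : (1 : ℝ) ≤ (q : ℝ) ^ θ₁ := Real.one_le_rpow (by linarith) hθ₁0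
    nlinarith
  linarith

end Literature.NumberTheory.Sieve

end
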